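import Literature.AnabelianGeometry.EtaleTheta.Discharge.Sec5DivTransportAssembly
import Literature.AnabelianGeometry.EtaleTheta.Discharge.Sec5Prop53ZeroPoleSplit

/-!
# [EtTh] §5, Thm. 5.6/5.7: the divisor transport at the root pair FROM PROPOSITION 5.3 BY NAME (F-2497) — G-w5d245-2 read through `GeometryOfDivisorsPreserved` (p.325–326, 329 / PDF pp.99–100, 103)

Mochizuki, *The étale theta function …*, Publ. RIMS **45** (2009): Prop. 5.3 (i)/(vi) p.325–326 (PDF pp.99–100); proof of Thm. 5.6
p.329 (PDF p.103) "since `Ψ` [essentially] preserves the divisor of zeroes and poles of `Θ̈` [cf. Proposition 5.3, (vi)] …"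
[cite: MochizukiEtTh2009, Prop 5.3 (vi) p.326 (PDF p.100); Thm 5.6 proof p.329 (PDF p.103)].

PROOF-ONLY (0 definitions, no new named fact).  abc-iut cell, layer L2, GAP G-w5d245-2 sequel (seat abc-iut-w5-d245 gen 4).  This
seat's assembly `ThetaFrobenioid.exists_aut_div_transport_eq_of_links` (p447656) took two inputs in "output" form — `induced`
(LINK (a)) and the SPLIT orbit equation `hsplit` (Prop. 5.3 (vi)+(i) at `A_⊚`).  Here BOTH are read off the typed Proposition 5.3
**by name** — abc-iut-L2-t4's `FrobenioidThetaDivisors.GeometryOfDivisorsPreserved T 𝔓 Ψ ι e` (FACT-LIST F-2497) at abc-iut-w6-d052's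
instantiation `T := DivisorTransportStub.ofThm49 𝔉` of the transport stub (LINK (a): `induced` then MEANS [FrdI] Thm. 4.9):
its field `induced` is LINK (a)'s input verbatim, and its fields `thetaOrbit` (vi) + `primes` (i) give `hsplit` through
abc-iut-w6-d043's LINK (c) `DivisorSupportData'.psiPhi_eq_pullAut_split_of_supp'`, GIVEN the divisor-support data of the
genuine special fibre in abc-iut-L6-d1's repaired vocabulary (`𝔖 : DivisorSupportData' 𝔓`), the decomposition of `div(Θ̈)` into a
cuspidally supported zero part `Z₀` and a non-cuspidally supported pole part `W₀` (Prop. 1.4 (i): "the zeroes of `Θ̈` … are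
precisely the cusps …; the divisor of poles … is precisely the divisor `D₁`"), and cuspidality preservation by the `Aut_C(A_⊚)`-action
(`hAut`, the binder of record of `Sec5Prop53ThetaOrbit`).
RESULT `exists_aut_div_transport_eq_of_geometryOfDivisorsPreserved`: `hdivA` at the anchor `α` ⟸ {F-2497 by name at `ofThm49`;
`𝔖`, `hZW`/`hZ`/`hW`, `hAut`; LINK (b) `hdesc`; LINK (d) structural inputs `hstrv`/`hGal`; `hiso`; cancellation `htf`/`hof`}.
HONEST FRAMING: kernel-checked implication; F-2497 is CONSUMED as a hypothesis, never discharged; the support data and the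
decomposition are hypotheses on the genuine special fibre, asserted nowhere; typed ≠ discharged; no side taken on [IUTchIII] Cor. 3.12.
-/

namespace Literature.AnabelianGeometry.EtaleTheta

open CategoryTheory Literature.AlgebraicGeometry.Frobenioids

universe w v v' u u'

namespace ThetaFrobenioid

variable {C : Type u} [Category.{v} C] {D : Type u'} [Category.{v'} D] (𝔉 : ThetaFrobenioid.{w} C D)

/-- **Prop. 5.3 (vi) + (i) in SPLIT form, from F-2497 by name**: if `Ψ^Φ_{A_⊚}` preserves the `Aut_C(A_⊚)`-orbit of
`div(Θ̈) = Z₀·W₀⁻¹` (field `thetaOrbit`) and cuspidality of primes (field `primes`), then for the zero part `Z₀` (cuspidally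
supported) and the pole part `W₀` (non-cuspidally supported) SEPARATELY `(Ψ^Φ)^gp Z₀ = g·Z₀`, `(Ψ^Φ)^gp W₀ = g·W₀` for one
`g ∈ Aut_C(A_⊚)` — abc-iut-w6-d043's LINK (c) over abc-iut-L6-d1's `DivisorSupportData'`.
[cite: MochizukiEtTh2009, Prop 5.3 (i) p.325 (PDF p.99); Prop 5.3 (vi) p.326 (PDF p.100)] -/
theorem exists_split_of_geometryOfDivisorsPreserved {T : FrobenioidThetaDivisors.DivisorTransportStub 𝔉}
    {𝔓 : FrobenioidThetaDivisors.DivisorPrimeData 𝔉} (𝔖 : FrobenioidThetaDivisors.DivisorSupportData' 𝔓) {Ψ : C ≌ C}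
    {ι : Ψ.functor.obj 𝔉.Acirc ≅ 𝔉.Acirc} {eΦ : 𝔉.PhiAcirc ≃* 𝔉.pre.Mon (𝔉.base.obj (Ψ.functor.obj 𝔉.Acirc))}
    (hGDP : FrobenioidThetaDivisors.GeometryOfDivisorsPreserved T 𝔓 Ψ ι eΦ)
    (hAut : ∀ (g : Aut 𝔉.Acirc) 𝔭, 𝔓.IsCuspidal (Primes.congr (𝔉.pullAut g) 𝔭) ↔ 𝔓.IsCuspidal 𝔭)
    {Z₀ W₀ : Algebra.GrothendieckGroup 𝔉.PhiAcirc} (hZW : 𝔓.divTheta = Z₀ * W₀⁻¹)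
    (hZ : 𝔖.IsCuspidalGp Z₀) (hW : ∀ 𝔭 ∈ 𝔖.supp W₀, ¬ 𝔓.IsCuspidal 𝔭) :
    ∃ g : Aut 𝔉.Acirc,
      ThetaFrobenioid.gpMap (FrobenioidThetaDivisors.psiPhi 𝔉 Ψ ι eΦ : 𝔉.PhiAcirc →* 𝔉.PhiAcirc) Z₀ =
        ThetaFrobenioid.gpMap (𝔉.pullAut g : 𝔉.PhiAcirc →* 𝔉.PhiAcirc) Z₀ ∧
      ThetaFrobenioid.gpMap (FrobenioidThetaDivisors.psiPhi 𝔉 Ψ ι eΦ : 𝔉.PhiAcirc →* 𝔉.PhiAcirc) W₀ =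
        ThetaFrobenioid.gpMap (𝔉.pullAut g : 𝔉.PhiAcirc →* 𝔉.PhiAcirc) W₀ := by
  -- (vi): `div Θ̈` lies in its own orbit, hence so does its `Ψ^Φ`-image
  have hmem : ThetaFrobenioid.gpMap (FrobenioidThetaDivisors.psiPhi 𝔉 Ψ ι eΦ : 𝔉.PhiAcirc →* 𝔉.PhiAcirc) 𝔓.divTheta ∈
      Set.range fun g : Aut 𝔉.Acirc => ThetaFrobenioid.gpMap (𝔉.pullAut g : 𝔉.PhiAcirc →* 𝔉.PhiAcirc) 𝔓.divTheta := by
    rw [← hGDP.thetaOrbit]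
    exact ⟨𝔓.divTheta, ⟨1, 𝔉.gpMap_pullAut_one_apply 𝔓.divTheta⟩, rfl⟩
  obtain ⟨g, hg⟩ := hmem
  refine ⟨g, 𝔖.psiPhi_eq_pullAut_split_of_supp' Ψ ι eΦ hGDP.primes g (hAut g) hZ hW ?_⟩
  rw [← hZW]
  exact hg.symm

/-- **G-w5d245-2 read through PROPOSITION 5.3 BY NAME** (F-2497 at `T := DivisorTransportStub.ofThm49 𝔉`): the `β`-free divisor
transport `hdivA` at the anchor `α` — ONE `ε ∈ Aut_C(A_N)` with `Div(α⁻¹ ≫ Ψ(s^⊓_N)) = Div(ε ≫ s^⊓_N)` and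
`Div(α⁻¹ ≫ Ψ(s^⊔_N)) = Div(ε ≫ s^⊔_N)` — from `GeometryOfDivisorsPreserved` (fields `induced`, `primes`, `thetaOrbit`), the
special-fibre support data `𝔖` with the cuspidal/non-cuspidal decomposition `div(Θ̈) = Z₀·W₀⁻¹` and `hAut`, LINK (b) (`hdesc`),
LINK (d)'s structural inputs (`hstrv`, `hGal`), "isomorphisms are isometries" (`hiso`) and the cancellation laws of `Φ(A_N)`.
[cite: MochizukiEtTh2009, Thm 5.6 proof p.329 (PDF p.103); Prop 5.3 (vi) p.326 (PDF p.100)] -/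
theorem exists_aut_div_transport_eq_of_geometryOfDivisorsPreserved
    (hiso : ∀ ⦃X Y : C⦄ (c : X ≅ Y), 𝔉.pre.div c.hom = 1) (hstrv : 𝔉.StrvSection)
    (hGal : ∀ a b : 𝔉.base.obj 𝔉.AN ⟶ 𝔉.base.obj 𝔉.Acirc, ∃ σ : Aut (𝔉.base.obj 𝔉.AN), σ.hom ≫ a = b)
    {Ψ : C ≌ C} (ι : Ψ.functor.obj 𝔉.Acirc ≅ 𝔉.Acirc) (α : Ψ.functor.obj 𝔉.AN ≅ 𝔉.AN) (φ : 𝔉.AN ⟶ 𝔉.Acirc)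
    {eΦ : 𝔉.PhiAcirc ≃* 𝔉.pre.Mon (𝔉.base.obj (Ψ.functor.obj 𝔉.Acirc))}
    {𝔓 : FrobenioidThetaDivisors.DivisorPrimeData 𝔉} (𝔖 : FrobenioidThetaDivisors.DivisorSupportData' 𝔓)
    (hGDP : FrobenioidThetaDivisors.GeometryOfDivisorsPreserved (FrobenioidThetaDivisors.DivisorTransportStub.ofThm49 𝔉) 𝔓 Ψ ι eΦ)
    (hAut : ∀ (g : Aut 𝔉.Acirc) 𝔭, 𝔓.IsCuspidal (Primes.congr (𝔉.pullAut g) 𝔭) ↔ 𝔓.IsCuspidal 𝔭)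
    {Z₀ W₀ : Algebra.GrothendieckGroup 𝔉.PhiAcirc} (hZW : 𝔓.divTheta = Z₀ * W₀⁻¹)
    (hZ : 𝔖.IsCuspidalGp Z₀) (hW : ∀ 𝔭 ∈ 𝔖.supp W₀, ¬ 𝔓.IsCuspidal 𝔭)
    {n : ℕ}
    (hdesc : Algebra.GrothendieckGroup.of (𝔉.pre.div 𝔉.sCap) ^ n =
        AlgebraicGeometry.Frobenioids.gpMap (𝔉.pre.pull (𝔉.base.map φ)) Z₀ ∧
      Algebra.GrothendieckGroup.of (𝔉.pre.div 𝔉.sCup) ^ n =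
        AlgebraicGeometry.Frobenioids.gpMap (𝔉.pre.pull (𝔉.base.map φ)) W₀)
    (htf : ∀ x y : Algebra.GrothendieckGroup (𝔉.pre.Mon (𝔉.base.obj 𝔉.AN)), x ^ n = y ^ n → x = y)
    (hof : Function.Injective
      (Algebra.GrothendieckGroup.of : 𝔉.pre.Mon (𝔉.base.obj 𝔉.AN) → Algebra.GrothendieckGroup (𝔉.pre.Mon (𝔉.base.obj 𝔉.AN)))) :
    ∃ ε : Aut 𝔉.AN,
      𝔉.pre.div (α.inv ≫ Ψ.functor.map 𝔉.sCap) = 𝔉.pre.div (ε.hom ≫ 𝔉.sCap) ∧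
      𝔉.pre.div (α.inv ≫ Ψ.functor.map 𝔉.sCup) = 𝔉.pre.div (ε.hom ≫ 𝔉.sCup) :=
  𝔉.exists_aut_div_transport_eq_of_links hiso hstrv hGal ι α φ hGDP.induced Z₀ W₀
    (𝔉.exists_split_of_geometryOfDivisorsPreserved 𝔖 hGDP hAut hZW hZ hW) hdesc htf hof

end ThetaFrobenioid

end Literature.AnabelianGeometry.EtaleTheta
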